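import Summits.CriticalPhenomena.PercolationContinuityZ3.Theorems.PercNearOneGluingNoHeavyLowerTailSahiCTCLadderCubesGeneral
import HarnessLib

/-!
# `NoHeavyLowerTail` (crux stmt-CriticalPhenomena-4575), P3 lane: kinds of common `t`-sets inside an arbitrary cube of `(L_t)`

Support file (seat `prim-l12-p3`, gen 26; `--supports stmt-CriticalPhenomena-4575`).  README blueprint, step 1(c)/2 in general form.  For a
cube `(A, Y)` of a row (`A ⊆ D = dbl m`, `Y ⊆ T = lev m 1`; base `D ∖ A`, free `A ∪ (T ∖ Y)`, level `ℓ = t − #(D ∖ A)`), the charged pairs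
`(A', Y')` (`A' ⊆ D`, `#A' = j`, `Y' ⊆ T`, `#Y' = t − j`, `A' ∪ Y'` common) with `D ∖ A ⊆ A'` and `Y' ⊆ T ∖ Y` inject into the common
`ℓ`-sets of the cube by `(A', Y') ↦ (A' ∩ A) ∪ Y'`, and a point `p ∈ A` is in the image iff `p ∈ A'`
(`card_kindsIn_filter_le_csetsT`).  This is the incidence half of every supply fact (plain: no condition on `p`; pinned at `p`: the two
filters).  Nothing is asserted about the crux.
-/

namespace Summit.CriticalPhenomena.PercolationContinuityZ3.Theorems.SahiCTCForms

open Finset MvPolynomial SahiCTCGenFun SahiCTCWeightedLYM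

variable {α : Type*} [DecidableEq α] [Fintype α]

section KindsGeneral
variable {𝒳 𝒵 : Finset (Finset α)}

/-- The charged pairs of kind `j` that live in the cube `(A, Y)`. [this work] -/
def kindsIn (𝒳 𝒵 : Finset (Finset α)) (m : α →₀ ℕ) (t j : ℕ) (A Y : Finset α) : Finset (Finset α × Finset α) :=
  (((dbl m).powersetCard j) ×ˢ ((lev m 1).powersetCard (t - j))).filter fun q =>
    (q.1 ∪ q.2 ∈ 𝒳 ∧ q.1 ∪ q.2 ∈ 𝒵) ∧ dbl m \ A ⊆ q.1 ∧ Disjoint q.2 Y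

omit [Fintype α] in
/-- Membership in `kindsIn`. [this work] -/
theorem mem_kindsIn {m : α →₀ ℕ} {t j : ℕ} {A Y : Finset α} {q : Finset α × Finset α} :
    q ∈ kindsIn 𝒳 𝒵 m t j A Y ↔ (q.1 ⊆ dbl m ∧ #q.1 = j) ∧ (q.2 ⊆ lev m 1 ∧ #q.2 = t - j) ∧
      (q.1 ∪ q.2 ∈ 𝒳 ∧ q.1 ∪ q.2 ∈ 𝒵) ∧ dbl m \ A ⊆ q.1 ∧ Disjoint q.2 Y := by
  unfold kindsIn
  rw [mem_filter, mem_product, mem_powersetCard, mem_powersetCard]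
  tauto

omit [Fintype α] in
/-- **Incidence**: the pairs of `kindsIn … j A Y` satisfying a condition on `A' ∩ A ∪ Y'` inject into the common `ℓ`-sets of the cube
`(D ∖ A, A ∪ (T ∖ Y))` with `ℓ = t − #(D ∖ A)` satisfying the same condition. [this work] -/
theorem card_kindsIn_filter_le_csetsT {m : α →₀ ℕ} {t j : ℕ} {A Y : Finset α} (hA : A ⊆ dbl m)
    (hjt : j ≤ t) (hDA : #(dbl m \ A) ≤ j) (P : Finset α → Prop) [DecidablePred P] :
    #((kindsIn 𝒳 𝒵 m t j A Y).filter fun q => P (q.1 ∩ A ∪ q.2))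
      ≤ #((csetsT 𝒳 𝒵 (dbl m \ A) (A ∪ (lev m 1 \ Y)) (t - #(dbl m \ A))).filter P) := by
  have hDT := disjoint_dbl_lev_one m
  refine card_le_card_of_injOn (fun q => q.1 ∩ A ∪ q.2) (fun q hq => ?_) (fun q hq q' hq' h => ?_)
  · obtain ⟨hq, hP⟩ := mem_filter.1 (Finset.mem_coe.1 hq)
    obtain ⟨⟨hA', hj'⟩, ⟨hY', hY'c⟩, ⟨hX, hZ⟩, hsub, hdisj⟩ := mem_kindsIn.1 hq
    refine Finset.mem_coe.2 (mem_filter.2 ⟨mem_csetsT.2 ⟨?_, ?_, ?_, ?_⟩, hP⟩)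
    · -- inside the free set
      refine union_subset_union inter_subset_right (fun y hy => mem_sdiff.2 ⟨hY' hy, fun hyY => disjoint_left.1 hdisj hy hyY⟩)
    · -- size
      have hdAY : Disjoint (q.1 ∩ A) q.2 := Disjoint.mono (inter_subset_left.trans hA') hY' hDT
      have hsplit : #(q.1 ∩ A) + #(dbl m \ A) = #q.1 := by
        have hd : Disjoint (q.1 ∩ A) (dbl m \ A) :=
          disjoint_left.2 fun i hi hi' => (mem_sdiff.1 hi').2 (mem_inter.1 hi).2
        rw [← card_union_of_disjoint hd]
        congr 1
        ext i; simp only [mem_union, mem_inter, mem_sdiff]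
        constructor
        · rintro (⟨hi, _⟩ | hi)
          · exact hi
          · exact hsub (mem_sdiff.2 hi)
        · intro hi
          by_cases hiA : i ∈ A
          · exact Or.inl ⟨hi, hiA⟩
          · exact Or.inr ⟨hA' hi, hiA⟩
      rw [card_union_of_disjoint hdAY, hY'c]; omega
    · have e : dbl m \ A ∪ (q.1 ∩ A ∪ q.2) = q.1 ∪ q.2 := by
        ext i; simp only [mem_union, mem_sdiff, mem_inter]
        constructor
        · rintro (⟨hi, hiA⟩ | ⟨hi, _⟩ | hi)
          · exact Or.inl (hsub (mem_sdiff.2 ⟨hi, hiA⟩))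
          · exact Or.inl hi
          · exact Or.inr hi
        · rintro (hi | hi)
          · by_cases hiA : i ∈ A
            · exact Or.inr (Or.inl ⟨hi, hiA⟩)
            · exact Or.inl ⟨hA' hi, hiA⟩
          · exact Or.inr (Or.inr hi)
      rw [e]; exact hX
    · have e : dbl m \ A ∪ (q.1 ∩ A ∪ q.2) = q.1 ∪ q.2 := by
        ext i; simp only [mem_union, mem_sdiff, mem_inter]
        constructor
        · rintro (⟨hi, hiA⟩ | ⟨hi, _⟩ | hi)
          · exact Or.inl (hsub (mem_sdiff.2 ⟨hi, hiA⟩))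
          · exact Or.inl hi
          · exact Or.inr hi
        · rintro (hi | hi)
          · by_cases hiA : i ∈ A
            · exact Or.inr (Or.inl ⟨hi, hiA⟩)
            · exact Or.inl ⟨hA' hi, hiA⟩
          · exact Or.inr (Or.inr hi)
      rw [e]; exact hZ
  · obtain ⟨hq, _⟩ := mem_filter.1 (Finset.mem_coe.1 hq)
    obtain ⟨hq', _⟩ := mem_filter.1 (Finset.mem_coe.1 hq')
    obtain ⟨⟨hA1, _⟩, ⟨hY1, _⟩, _, hsub1, _⟩ := mem_kindsIn.1 hq
    obtain ⟨⟨hA2, _⟩, ⟨hY2, _⟩, _, hsub2, _⟩ := mem_kindsIn.1 hq'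
    have h' : q.1 ∩ A ∪ q.2 = q'.1 ∩ A ∪ q'.2 := h
    have e1 : q.1 ∩ A = q'.1 ∩ A := by
      have e := congrArg (fun s => s ∩ dbl m) h'
      simp only [union_inter_distrib_right, disjoint_iff_inter_eq_empty.1 (hDT.symm.mono_left hY1),
        disjoint_iff_inter_eq_empty.1 (hDT.symm.mono_left hY2), union_empty] at e
      rwa [inter_assoc, inter_eq_left.2 hA, inter_assoc, inter_eq_left.2 hA] at e
    have e2 : q.2 = q'.2 := by
      have e := congrArg (fun s => s ∩ lev m 1) h'
      simp only [union_inter_distrib_right, inter_eq_left.2 hY1, inter_eq_left.2 hY2, inter_assoc,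
        disjoint_iff_inter_eq_empty.1 (hDT.mono_left hA), inter_empty, empty_union] at e
      exact e
    have e3 : q.1 = q'.1 := by
      have r1 : q.1 = dbl m \ A ∪ q.1 ∩ A := by
        ext i; simp only [mem_union, mem_sdiff, mem_inter]
        constructor
        · intro hi; by_cases hiA : i ∈ A
          · exact Or.inr ⟨hi, hiA⟩
          · exact Or.inl ⟨hA1 hi, hiA⟩
        · rintro (hi | ⟨hi, _⟩)
          · exact hsub1 (mem_sdiff.2 hi)
          · exact hi
      have r2 : q'.1 = dbl m \ A ∪ q'.1 ∩ A := by
        ext i; simp only [mem_union, mem_sdiff, mem_inter]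
        constructor
        · intro hi; by_cases hiA : i ∈ A
          · exact Or.inr ⟨hi, hiA⟩
          · exact Or.inl ⟨hA2 hi, hiA⟩
        · rintro (hi | ⟨hi, _⟩)
          · exact hsub2 (mem_sdiff.2 hi)
          · exact hi
      rw [r1, r2, e1]
    exact Prod.ext e3 e2

end KindsGeneral

end Summit.CriticalPhenomena.PercolationContinuityZ3.Theorems.SahiCTCForms
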